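import Summits.HubbardSuperconductivity.HubbardSuperconductivity.Theorems.FunctionFieldCertificateAssemblyFejerGlue
import Literature.MathematicalPhysics.QuantumLattice.FockRelabel
import Literature.MathematicalPhysics.QuantumLattice.HubbardWave0RepulsiveProofs
import Literature.MathematicalPhysics.QuantumLattice.HubbardRingPerronFrobeniusProofs
import HarnessLib

/-!
# Crux `MesoscopicPairOrder` (stmt-HubbardSuperconductivity-7331) — window transfer, file 1 of 2:
# the window constraints satisfied by the translates of a sector ground state

Supports item `stmt-HubbardSuperconductivity-7331` (route `FunctionFieldCertificate`, pole-free crux; open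
physics, not settled here). Helper file for `Theorems/FunctionFieldCertificateMesoscopicPairOrderBoxTransfer.lean`,
which kernel-checks the composition theorem `BoxOrder → MesoscopicPairOrder` of the crux-idea card
`window-stationarity-box-transfer` (`BoxOrderGivesCrux`). The proof there is the card's own: the TRANSLATION
AVERAGE `ρ̄ = L⁻² Σ_v |T_v ψ⟩⟨T_v ψ|` of a normalised sector ground state `ψ` (`T_v = fockTranslate v`) is a
ground-state mixture satisfying every window constraint exactly, and its sub-window pair weight is the crux
functional. This file proves the per-translate facts (no definition is introduced; sub-windows are written in
the tree's block vocabulary `B'_u = Σ_{w : Fin 2 → Fin R'} P_{u + w}` of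
`FunctionFieldCertificateAssembly.re_sum_star_blockMulVec_dotProduct_eq`):

* `trace_proj_mul`, `proj_posSemidef`, `commute_proj_totalNumberOp` — `Tr(|ψ⟩⟨ψ| M) = ⟨ψ, Mψ⟩`,
  `|ψ⟩⟨ψ| ⪰ 0`, `[|ψ⟩⟨ψ|, N̂] = 0` for an `N`-particle `ψ`;
* `stationarity_trace_of_ground` — (S) in trace form: `0 ≤ Re Tr(|ψ⟩⟨ψ| Qᴴ (H_L Q - Q H_L))` for every
  `(2n, 0)`-sector ground state `ψ` of `H_L = hubbardTorus 2 L 1 U` and EVERY `Q` commuting with `N̂` (the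
  tree's `sectorStationarity` + `LiebTwo.isNParticle_mulVec_of_commute`);
* `expect_translate_relabel`, `sum_expect_translate_relabel` — (T): `⟨T_v ψ, τ_u(A) T_v ψ⟩ =
  ⟨T_{v-u} ψ, A T_{v-u} ψ⟩`, hence `Σ_v ⟨T_v ψ, τ_u(A) T_v ψ⟩ = Σ_v ⟨T_v ψ, A T_v ψ⟩` for EVERY matrix `A`;
* `expect_translate_numberOp`, `sum_sum_expect_translate_numberOp` — (D): `Σ_σ Σ_v ⟨T_v ψ, n_{xσ} T_v ψ⟩ =
  N ⟨ψ, ψ⟩` at every site `x` for an `N`-particle `ψ`;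
* `expect_translate_block`, `sum_expect_translate_block` — for `0 < R'`, `2R' ≤ L` and EVERY anchor `u`:
  `Σ_v Re⟨T_v ψ, B'_uᴴ B'_u T_v ψ⟩ = Σ_a ‖B'_a ψ‖² = R'² T_{R'}(ψ)` (tent identity) — the sub-window pair weight
  of `ρ̄` IS the crux functional at scale `R'`;
* `abs_pairNumber_div_sub_le` — `|N_L/L² - (1 - δ)| ≤ 2/L²` for the route's `N_L = 2⌊(1-δ)L²/2⌋`;
* `translationAverageDictionary` — registered form of `sum_expect_translate_block`.

Sources: Tasaki (2020) §2.1, §4.1 (variational principle, lattice translations); Pironio–Navascués–Acín,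
SIAM J. Optim. 20 (2010) 2157 §2 (first-order state constraints); Stein–Shakarchi, *Fourier Analysis* Ch. 2
(Fejér = box autocorrelation). All folklore.
-/

noncomputable section

-- the summit namespace `Summit.HubbardSuperconductivity.HubbardSuperconductivity.…` repeats the problem name by design (D-0017)
set_option linter.dupNamespace false

namespace Summit.HubbardSuperconductivity.HubbardSuperconductivity.Theorems.FunctionFieldCertificate

open Matrix Finset Filter
open Literature.Probability.LatticeModels Literature.MathematicalPhysics.QuantumLattice
open scoped ComplexOrder

/-! ### §1 Window constraints of the translates of a ground state -/

section Constraints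

variable {L : ℕ} [NeZero L]

omit [NeZero L] in
/-- `Tr (|ψ⟩⟨ψ| M) = ⟨ψ, M ψ⟩` on the fermionic Fock space of the torus. [folklore] -/
theorem trace_proj_mul (ψ : Fock (Orb (FermionTorus 2 L)))
    (M : Matrix (Finset (Orb (FermionTorus 2 L))) (Finset (Orb (FermionTorus 2 L))) ℂ) :
    (vecMulVec ψ (star ψ) * M).trace = star ψ ⬝ᵥ M *ᵥ ψ := by
  rw [vecMulVec_mul, trace_vecMulVec, dotProduct_comm, dotProduct_mulVec]

omit [NeZero L] in
/-- `|ψ⟩⟨ψ| ⪰ 0`. [folklore] -/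
theorem proj_posSemidef (ψ : Fock (Orb (FermionTorus 2 L))) : (vecMulVec ψ (star ψ)).PosSemidef :=
  posSemidef_vecMulVec_self_star ψ

omit [NeZero L] in
/-- A matrix commuting with `N̂` preserves each `N`-particle sector (the tree's
`LiebTwo.isNParticle_mulVec_of_commute`, with `totalNumberOp = totalNumber`). [folklore] -/
theorem isNParticle_mulVec_of_commute_totalNumberOp {N : ℕ} {ψ : Fock (Orb (FermionTorus 2 L))}
    (hψ : IsNParticle N ψ) {Q : Matrix (Finset (Orb (FermionTorus 2 L))) (Finset (Orb (FermionTorus 2 L))) ℂ}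
    (hQ : Commute Q totalNumberOp) : IsNParticle N (Q *ᵥ ψ) := by
  refine LiebTwo.isNParticle_mulVec_of_commute hψ ?_
  rw [← totalNumberOp_eq_totalNumber]
  exact hQ.eq.symm

omit [NeZero L] in
/-- `[|ψ⟩⟨ψ|, N̂] = 0` for an `N`-particle vector `ψ` (`U(1)` block structure of the state). [folklore] -/
theorem commute_proj_totalNumberOp {N : ℕ} {ψ : Fock (Orb (FermionTorus 2 L))} (hψ : IsNParticle N ψ) :
    Commute (vecMulVec ψ (star ψ)) (totalNumberOp : Matrix (Finset (Orb (FermionTorus 2 L))) _ ℂ) := by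
  rw [totalNumberOp_eq_totalNumber]
  have hN : (totalNumber : Matrix (Finset (Orb (FermionTorus 2 L))) _ ℂ) *ᵥ ψ = (N : ℂ) • ψ :=
    (LiebTwo.isNParticle_iff_totalNumber N ψ).1 hψ
  have hvec : star ψ ᵥ* (totalNumber : Matrix (Finset (Orb (FermionTorus 2 L))) _ ℂ) = (N : ℂ) • star ψ := by
    have h1 : star ψ ᵥ* (totalNumber : Matrix (Finset (Orb (FermionTorus 2 L))) _ ℂ) =
        star ((totalNumber : Matrix (Finset (Orb (FermionTorus 2 L))) _ ℂ)ᴴ *ᵥ ψ) := by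
      rw [star_mulVec, conjTranspose_conjTranspose]
    rw [h1, totalNumber_isHermitian.eq, hN, star_smul]
    congr 1
    simp
  change vecMulVec ψ (star ψ) * totalNumber = totalNumber * vecMulVec ψ (star ψ)
  rw [vecMulVec_mul, mul_vecMulVec, hvec, hN, vecMulVec_smul, smul_vecMulVec]

omit [NeZero L] in
/-- `⟨ψ, (Aᴴ B) ψ⟩ = ⟨Aψ, Bψ⟩`. [folklore] -/
theorem expect_conjTranspose_mul_eq (A B : Matrix (Finset (Orb (FermionTorus 2 L))) (Finset (Orb (FermionTorus 2 L))) ℂ)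
    (ψ : Fock (Orb (FermionTorus 2 L))) :
    star ψ ⬝ᵥ (Aᴴ * B) *ᵥ ψ = star (A *ᵥ ψ) ⬝ᵥ (B *ᵥ ψ) := by
  rw [← mulVec_mulVec, dotProduct_mulVec, star_mulVec]

omit [NeZero L] in
/-- **(S) Stationarity in trace form.** For a `(2n, S^z = 0)`-sector ground state `ψ` of
`H = hubbardTorus 2 L 1 U` and every `Q` commuting with `N̂`: `0 ≤ Re Tr(|ψ⟩⟨ψ| · Qᴴ (HQ - QH))`. By `SU(2)` the
joint-sector ground energy is the `2n`-particle ground energy (`groundEnergyAt_eq_minEnergyOn_szSector`), `Qψ`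
stays in the `2n`-particle sector, and `(HQ - QH)ψ = (H - E₀)(Qψ)` is controlled by the variational principle
(`LiebThm1.groundEnergy_mul_norm_le`) — the argument of the tree's `sectorStationarity`, re-run here in trace
form so that this file's import closure stays within Literature and the Fejér glue. Pironio–Navascués–Acín
(2010) §2; Lieb, PRL 62 (1989) 1201. [folklore] -/
theorem stationarity_trace_of_ground (U : ℝ) (n : ℕ) {ψ : Fock (Orb (FermionTorus 2 L))}
    (hgs : IsGroundStateInSector (hubbardTorus 2 L 1 U) (2 * n) 0 ψ)
    (Q : Matrix (Finset (Orb (FermionTorus 2 L))) (Finset (Orb (FermionTorus 2 L))) ℂ)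
    (hQ : Commute Q totalNumberOp) :
    0 ≤ ((vecMulVec ψ (star ψ) *
      (Qᴴ * (hubbardTorus 2 L 1 U * Q - Q * hubbardTorus 2 L 1 U))).trace).re := by
  rw [trace_proj_mul, ← mulVec_mulVec, dotProduct_mulVec, ← star_mulVec]
  set H := hubbardTorus 2 L 1 U with hH
  set E₀ : ℝ := H.minEnergyOn (szSector (2 * n) 0) with hE₀
  obtain ⟨hψK, hne, heig⟩ := hgs
  -- the sector is not empty: `n ≤ |Λ_L|`
  have hn : n ≤ Fintype.card (FermionTorus 2 L) := by
    by_contra hlt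
    apply hne
    funext s
    refine (mem_szSector_two_mul_zero_iff n ψ).1 hψK s fun h => ?_
    have : (upPart s).card ≤ Fintype.card (FermionTorus 2 L) := Finset.card_le_univ _
    omega
  -- `SU(2)`: the joint-sector ground energy is the `2n`-particle ground energy
  have hSU2 : groundEnergy H (2 * n) = E₀ :=
    groundEnergyAt_eq_minEnergyOn_szSector (fermionTorusGraph 2 L) 1 U hn
  -- `Qψ` is a `2n`-particle vector
  have hψN : IsNParticle (2 * n) ψ := ((mem_szSector_iff _ _ _).1 hψK).1
  have hQψN : IsNParticle (2 * n) (Q *ᵥ ψ) := isNParticle_mulVec_of_commute_totalNumberOp hψN hQ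
  -- the commutator acting on the ground state
  have hcomm : (H * Q - Q * H) *ᵥ ψ = H *ᵥ (Q *ᵥ ψ) - ((E₀ : ℝ) : ℂ) • (Q *ᵥ ψ) := by
    rw [Matrix.sub_mulVec, ← Matrix.mulVec_mulVec, ← Matrix.mulVec_mulVec, heig, Matrix.mulVec_smul]
  rw [hcomm, dotProduct_sub, dotProduct_smul, Complex.sub_re, smul_eq_mul, Complex.re_ofReal_mul]
  -- variational principle in the `2n`-particle sector
  have hvar := LiebThm1.groundEnergy_mul_norm_le H hQψN
  rw [hSU2] at hvar
  change E₀ * (star (Q *ᵥ ψ) ⬝ᵥ (Q *ᵥ ψ)).re ≤ (star (Q *ᵥ ψ) ⬝ᵥ (H *ᵥ (Q *ᵥ ψ))).re at hvar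
  linarith

/-- **(T) for translates**: `⟨T_v ψ, τ_u(A) T_v ψ⟩ = ⟨T_{v-u} ψ, A T_{v-u} ψ⟩` for every matrix `A`
(`T_v = T_u T_{v-u}` and `⟨T_u φ, τ_u(A) T_u φ⟩ = ⟨φ, A φ⟩`). [folklore] -/
theorem expect_translate_relabel (ψ : Fock (Orb (FermionTorus 2 L))) (v u : TorusSite 2 L)
    (A : Matrix (Finset (Orb (FermionTorus 2 L))) (Finset (Orb (FermionTorus 2 L))) ℂ) :
    star ((fockTranslate v).val *ᵥ ψ) ⬝ᵥ relabel (Orb.translate u) A *ᵥ ((fockTranslate v).val *ᵥ ψ) =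
      star ((fockTranslate (v - u)).val *ᵥ ψ) ⬝ᵥ A *ᵥ ((fockTranslate (v - u)).val *ᵥ ψ) := by
  have hmul : (fockTranslate (u + (v - u))).val = (fockTranslate u).val * (fockTranslate (v - u)).val := by
    rw [fockTranslate_add]
    rfl
  have hv : (fockTranslate v).val *ᵥ ψ =
      (fockTranslate u).val *ᵥ ((fockTranslate (v - u)).val *ᵥ ψ) := by
    rw [mulVec_mulVec, ← hmul, add_sub_cancel]
  rw [hv]
  exact expect_relabel_fockRelabel_mulVec (Orb.translate u) A _

/-- **(T) summed**: `Σ_v ⟨T_v ψ, τ_u(A) T_v ψ⟩ = Σ_v ⟨T_v ψ, A T_v ψ⟩` (reindex `v ↦ v - u`). [folklore] -/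
theorem sum_expect_translate_relabel (ψ : Fock (Orb (FermionTorus 2 L))) (u : TorusSite 2 L)
    (A : Matrix (Finset (Orb (FermionTorus 2 L))) (Finset (Orb (FermionTorus 2 L))) ℂ) :
    ∑ v : TorusSite 2 L, star ((fockTranslate v).val *ᵥ ψ) ⬝ᵥ relabel (Orb.translate u) A *ᵥ
        ((fockTranslate v).val *ᵥ ψ) =
      ∑ v : TorusSite 2 L, star ((fockTranslate v).val *ᵥ ψ) ⬝ᵥ A *ᵥ ((fockTranslate v).val *ᵥ ψ) := by
  simp_rw [expect_translate_relabel]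
  exact Fintype.sum_equiv (Equiv.subRight u) _ _ fun v => rfl

/-- One-site densities of a translate: `⟨T_v ψ, n_{xσ} T_v ψ⟩ = ⟨ψ, n_{x-v,σ} ψ⟩`. [folklore] -/
theorem expect_translate_numberOp (ψ : Fock (Orb (FermionTorus 2 L))) (v x : TorusSite 2 L) (σ : Fin 2) :
    star ((fockTranslate v).val *ᵥ ψ) ⬝ᵥ numberOp (FermionTorus.ofTorusSite x) σ *ᵥ ((fockTranslate v).val *ᵥ ψ) =
      star ψ ⬝ᵥ numberOp (FermionTorus.ofTorusSite (x - v)) σ *ᵥ ψ := by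
  have h := expect_relabel_fockRelabel_mulVec (Orb.translate v) (numberOp (FermionTorus.ofTorusSite (x - v)) σ) ψ
  rw [relabel_translate_numberOp, sub_add_cancel] at h
  exact h

/-- **(D) for translates**: for an `N`-particle `ψ`, `Σ_σ Σ_v ⟨T_v ψ, n_{xσ} T_v ψ⟩ = N ⟨ψ, ψ⟩` at every
site `x` (the translates sweep `n_{xσ}` over all sites, and `Σ_{y,σ} n_{yσ} = N̂`). [folklore] -/
theorem sum_sum_expect_translate_numberOp {N : ℕ} {ψ : Fock (Orb (FermionTorus 2 L))} (hN : IsNParticle N ψ)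
    (x : TorusSite 2 L) :
    ∑ σ : Fin 2, ∑ v : TorusSite 2 L, star ((fockTranslate v).val *ᵥ ψ) ⬝ᵥ
        numberOp (FermionTorus.ofTorusSite x) σ *ᵥ ((fockTranslate v).val *ᵥ ψ) =
      (N : ℂ) * (star ψ ⬝ᵥ ψ) := by
  -- `⟨ψ, N̂ ψ⟩ = N ⟨ψ, ψ⟩`
  have htot : star ψ ⬝ᵥ (totalNumber : Matrix (Finset (Orb (FermionTorus 2 L))) _ ℂ) *ᵥ ψ =
      (N : ℂ) * (star ψ ⬝ᵥ ψ) := by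
    rw [(LiebTwo.isNParticle_iff_totalNumber N ψ).1 hN, dotProduct_smul, smul_eq_mul]
  -- `⟨ψ, N̂ ψ⟩ = Σ_y Σ_σ ⟨ψ, n_{yσ} ψ⟩`
  have hsum : star ψ ⬝ᵥ (totalNumber : Matrix (Finset (Orb (FermionTorus 2 L))) _ ℂ) *ᵥ ψ =
      ∑ y : TorusSite 2 L, ∑ σ : Fin 2, star ψ ⬝ᵥ numberOp (FermionTorus.ofTorusSite y) σ *ᵥ ψ := by
    unfold totalNumber
    rw [Matrix.sum_mulVec, dotProduct_sum]
    refine Fintype.sum_equiv (FermionTorus.equivTorusSite) _ _ fun y => ?_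
    rw [Matrix.sum_mulVec, dotProduct_sum]
    refine Finset.sum_congr rfl fun σ _ => ?_
    rw [show FermionTorus.equivTorusSite y = FermionTorus.toTorusSite y from rfl,
      FermionTorus.ofTorusSite_toTorusSite]
  rw [← htot, hsum, Finset.sum_comm]
  refine Fintype.sum_equiv (Equiv.subLeft x) _ _ fun v => ?_
  refine Finset.sum_congr rfl fun σ _ => ?_
  rw [expect_translate_numberOp, Equiv.subLeft_apply]

/-- The block pair field at a general anchor translates covariantly: `τ_v(B'_a) = B'_{a+v}`. [folklore] -/
theorem relabel_translate_blockPair (R' : ℕ) (v a : TorusSite 2 L) :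
    relabel (Orb.translate v)
        (∑ w : Fin 2 → Fin R', localPair dWaveFormFactor L (a + fun i => ((w i : ℕ) : ZMod L))) =
      ∑ w : Fin 2 → Fin R', localPair dWaveFormFactor L (a + v + fun i => ((w i : ℕ) : ZMod L)) := by
  rw [relabel_sum]
  refine Finset.sum_congr rfl fun w _ => ?_
  rw [relabel_translate_localPair, add_right_comm]

/-- Sub-window pair weight of a translate: `⟨T_v ψ, B'_uᴴ B'_u T_v ψ⟩ = ⟨ψ, B'_{u-v}ᴴ B'_{u-v} ψ⟩`.
[folklore] -/
theorem expect_translate_block (R' : ℕ) (ψ : Fock (Orb (FermionTorus 2 L))) (v u : TorusSite 2 L) :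
    star ((fockTranslate v).val *ᵥ ψ) ⬝ᵥ
        ((∑ w : Fin 2 → Fin R', localPair dWaveFormFactor L (u + fun i => ((w i : ℕ) : ZMod L)))ᴴ *
          (∑ w : Fin 2 → Fin R', localPair dWaveFormFactor L (u + fun i => ((w i : ℕ) : ZMod L)))) *ᵥ
        ((fockTranslate v).val *ᵥ ψ) =
      star ψ ⬝ᵥ
        ((∑ w : Fin 2 → Fin R', localPair dWaveFormFactor L (u - v + fun i => ((w i : ℕ) : ZMod L)))ᴴ *
          (∑ w : Fin 2 → Fin R', localPair dWaveFormFactor L (u - v + fun i => ((w i : ℕ) : ZMod L)))) *ᵥ ψ := by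
  have h := expect_relabel_fockRelabel_mulVec (Orb.translate v)
    ((∑ w : Fin 2 → Fin R', localPair dWaveFormFactor L (u - v + fun i => ((w i : ℕ) : ZMod L)))ᴴ *
      (∑ w : Fin 2 → Fin R', localPair dWaveFormFactor L (u - v + fun i => ((w i : ℕ) : ZMod L)))) ψ
  rw [relabel_mul, relabel_conjTranspose, relabel_translate_blockPair, sub_add_cancel] at h
  exact h

/-- **The sub-window pair weight of the translation average IS the crux functional**: for `0 < R'`,
`2R' ≤ L` and EVERY anchor `u`, `Σ_v Re⟨T_v ψ, B'_uᴴ B'_u T_v ψ⟩ = Σ_a ‖B'_a ψ‖² = R'² T_{R'}(ψ)` (reindex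
`a = u - v`, then the tree's tent identity). [folklore] -/
theorem sum_expect_translate_block (R' : ℕ) (hR' : 0 < R') (hRL : 2 * R' ≤ L)
    (ψ : Fock (Orb (FermionTorus 2 L))) (u : TorusSite 2 L) :
    ∑ v : TorusSite 2 L, (star ((fockTranslate v).val *ᵥ ψ) ⬝ᵥ
        ((∑ w : Fin 2 → Fin R', localPair dWaveFormFactor L (u + fun i => ((w i : ℕ) : ZMod L)))ᴴ *
          (∑ w : Fin 2 → Fin R', localPair dWaveFormFactor L (u + fun i => ((w i : ℕ) : ZMod L)))) *ᵥ
        ((fockTranslate v).val *ᵥ ψ)).re =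
      (R' : ℝ) ^ 2 * ∑ x : TorusSite 2 L, ∑ y : TorusSite 2 L,
        (∏ i : Fin 2, max 0 (1 - |(((y i - x i).valMinAbs : ℤ) : ℝ)| / (R' : ℝ))) *
          (star (localPair dWaveFormFactor L x *ᵥ ψ) ⬝ᵥ (localPair dWaveFormFactor L y *ᵥ ψ)).re := by
  rw [← FunctionFieldCertificateAssembly.re_sum_star_blockMulVec_dotProduct_eq R' hR' hRL
    (localPair dWaveFormFactor L) ψ, Complex.re_sum]
  simp_rw [expect_translate_block R' ψ]
  refine Fintype.sum_equiv (Equiv.subLeft u) _ _ fun v => ?_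
  rw [Equiv.subLeft_apply, expect_conjTranspose_mul_eq]

end Constraints

/-! ### §2 The route's pair number -/

/-- The route's pair number is within `2` of `(1 - δ) L²`: `|2⌊(1-δ)L²/2⌋ / L² - (1 - δ)| ≤ 2 / L²`
for `δ ≤ 1`. [folklore] -/
theorem abs_pairNumber_div_sub_le (L : ℕ) [NeZero L] {δ : ℝ} (hδ : δ ≤ 1) :
    |((2 * ⌊(1 - δ) * (L : ℝ) ^ 2 / 2⌋₊ : ℕ) : ℝ) / (L : ℝ) ^ 2 - (1 - δ)| ≤ 2 / (L : ℝ) ^ 2 := by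
  have hLpos : (0 : ℝ) < L := Nat.cast_pos.2 (Nat.pos_of_ne_zero (NeZero.ne L))
  have hL2 : (0 : ℝ) < (L : ℝ) ^ 2 := by positivity
  have ht : 0 ≤ (1 - δ) * (L : ℝ) ^ 2 / 2 := by
    have : 0 ≤ 1 - δ := by linarith
    positivity
  have h1 : ((⌊(1 - δ) * (L : ℝ) ^ 2 / 2⌋₊ : ℕ) : ℝ) ≤ (1 - δ) * (L : ℝ) ^ 2 / 2 := Nat.floor_le ht
  have h2 : (1 - δ) * (L : ℝ) ^ 2 / 2 < ((⌊(1 - δ) * (L : ℝ) ^ 2 / 2⌋₊ : ℕ) : ℝ) + 1 := Nat.lt_floor_add_one _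
  have key : |((2 * ⌊(1 - δ) * (L : ℝ) ^ 2 / 2⌋₊ : ℕ) : ℝ) - (1 - δ) * (L : ℝ) ^ 2| ≤ 2 := by
    rw [abs_le]
    push_cast
    constructor <;> nlinarith
  have hrew : ((2 * ⌊(1 - δ) * (L : ℝ) ^ 2 / 2⌋₊ : ℕ) : ℝ) / (L : ℝ) ^ 2 - (1 - δ) =
      (((2 * ⌊(1 - δ) * (L : ℝ) ^ 2 / 2⌋₊ : ℕ) : ℝ) - (1 - δ) * (L : ℝ) ^ 2) / (L : ℝ) ^ 2 := by
    field_simp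
  rw [hrew, abs_div, abs_of_pos hL2]
  exact div_le_div_of_nonneg_right key hL2.le

/-- **Registered form of the translation-average dictionary** (sub-goal `translationAverageDictionary` of
crux stmt-HubbardSuperconductivity-7331, line `Sketch`; verbatim `sum_expect_translate_block`): for `0 < R'`,
`2R' ≤ L` and every anchor `u`, `Σ_v Re⟨T_v ψ, B'_uᴴ B'_u T_v ψ⟩ = R'² T_{R'}(ψ)`. [folklore] -/
theorem translationAverageDictionary : ∀ {L : ℕ} [NeZero L] (R' : ℕ), 0 < R' → 2 * R' ≤ L → ∀ (ψ : Fock (Orb (FermionTorus 2 L))) (u : TorusSite 2 L), (∑ v : TorusSite 2 L, (star ((fockTranslate v).val *ᵥ ψ) ⬝ᵥ ((∑ w : Fin 2 → Fin R', localPair dWaveFormFactor L (u + fun i => ((w i : ℕ) : ZMod L)))ᴴ * (∑ w : Fin 2 → Fin R', localPair dWaveFormFactor L (u + fun i => ((w i : ℕ) : ZMod L)))) *ᵥ ((fockTranslate v).val *ᵥ ψ)).re) = (R' : ℝ) ^ 2 * ∑ x : TorusSite 2 L, ∑ y : TorusSite 2 L, (∏ i : Fin 2, max 0 (1 - |(((y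 i - x i).valMinAbs : ℤ) : ℝ)| / (R' : ℝ))) * (star (localPair dWaveFormFactor L x *ᵥ ψ) ⬝ᵥ (localPair dWaveFormFactor L y *ᵥ ψ)).re :=
  fun R' hR' hRL ψ u => sum_expect_translate_block R' hR' hRL ψ u

end Summit.HubbardSuperconductivity.HubbardSuperconductivity.Theorems.FunctionFieldCertificate
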